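import Summits.AtomisticToContinuum.HydrodynamicLimit.Theorems.EquilibriumClampedCollisionalWindowLD.Negative.PulseCoarse

/-!
# Cradle pulse: adjacent spheres; jump times (helper file of the refutation of `EquilibriumClampedCollisionalWindowLD`, stmt-AtomisticToContinuum-13733; see `Cruxes/EquilibriumClampedCollisionalWindowLD/Disproof.lean` and the evidence WITNESS.md; no Theses declaration is asserted positively; refuter-cdisprove-stmt-AtomisticToContinuum-13733-0)
-/

noncomputable section

open Real
open scoped InnerProductSpace

namespace Summit.AtomisticToContinuum.HydrodynamicLimit.Theorems

namespace EquilibriumClampedCollisionalWindowLDNegative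

section BlockAll

variable {E : Type*} [NormedAddCommGroup E] [InnerProductSpace ℝ E]

section BlockTrajectory

variable {P : Params} {e : E} {D : BlockData E}

/-! ### Adjacent spheres -/

/-- Both untouched (`1 ≤ k`, `t < tHit k`). -/
theorem adj_uu (hP : P.Admissible) (hD : DataOK P e D) {k : ℕ} (hk1 : 1 ≤ k) (hk : k + 1 ≤ P.K)
    {t : ℝ} (ht0 : 0 ≤ t) (htT : t ≤ P.Tmax) (ht : t < tHit P e D k) :
    P.ε < ‖pos P e D (k + 1) t - pos P e D k t‖ := by
  have he := hD.e_unit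
  have hkK : k ≤ P.K := (Nat.le_succ k).trans hk
  have ht' : t < tHit P e D (k + 1) := ht.trans (tHit_lt_succ hP hD hk)
  rw [pos_untouched ht, pos_untouched ht', base, base]
  have hform : ((((k + 1 : ℕ) : ℝ) * P.s) • e + D.ξ (k + 1) + t • D.η (k + 1)) -
      ((((k : ℕ) : ℝ) * P.s) • e + D.ξ k + t • D.η k) =
      P.s • e + ((D.ξ (k + 1) - D.ξ k) + t • (D.η (k + 1) - D.η k)) := by
    push_cast
    rw [smul_sub, add_mul, one_mul, add_smul]
    abel
  rw [hform]
  have hse : ‖P.s • e‖ = P.s := by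
    rw [norm_smul, he, mul_one, Real.norm_of_nonneg hP.s_pos.le]
  have hpert : ‖(D.ξ (k + 1) - D.ξ k) + t • (D.η (k + 1) - D.η k)‖ ≤ P.δs := by
    calc ‖(D.ξ (k + 1) - D.ξ k) + t • (D.η (k + 1) - D.η k)‖
        ≤ ‖D.ξ (k + 1) - D.ξ k‖ + ‖t • (D.η (k + 1) - D.η k)‖ := norm_add_le _ _
      _ ≤ (P.r + P.r) + P.Tmax * (P.u + P.u) := by
          refine add_le_add ((norm_sub_le _ _).trans
            (add_le_add (hD.ξ_le _ hk) (hD.ξ_le _ hkK))) ?_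
          rw [norm_smul, Real.norm_of_nonneg ht0]
          exact mul_le_mul htT ((norm_sub_le _ _).trans (add_le_add
            (hD.η_le _ (Nat.succ_le_succ (Nat.zero_le _)) hk) (hD.η_le _ hk1 hkK)))
            (norm_nonneg _) hP.T_nn
      _ = P.δs := by unfold Params.δs; ring
  have h1 := norm_sub_norm_le (P.s • e) (-((D.ξ (k + 1) - D.ξ k) + t • (D.η (k + 1) - D.η k)))
  rw [hse, norm_neg, sub_neg_eq_add] at h1
  have hδν : P.δs ≤ P.νs := by
    unfold Params.νs; have : 0 ≤ P.ps ^ 2 / P.ε := by have := hP.ε_pos; positivity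
    linarith
  have := hP.νs_lt
  unfold Params.g at this
  linarith

/-- Carrier `k` flying towards the untouched `k+1`. -/
theorem adj_cu (hP : P.Admissible) (hD : DataOK P e D) {k : ℕ} (hk : k + 1 ≤ P.K) {t : ℝ}
    (h1 : tHit P e D k ≤ t) (h2 : t < tHit P e D (k + 1)) :
    P.ε < ‖pos P e D (k + 1) t - pos P e D k t‖ := by
  have hform : pos P e D (k + 1) t - pos P e D k t =
      relPos P e D k (carrier P e D k) - (t - tHit P e D k) • relVel D k (carrier P e D k) := by
    rw [pos_untouched h2, pos_carrier h1 h2, relPos, relVel, tHit, smul_sub]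
    module
  rw [hform]
  refine (stepFacts hP hD hk).cont.before _ (sub_nonneg.2 h1) ?_
  rw [tHit_succ] at h2; linarith

/-- The transfer itself: at `tHit (k+1)` the two spheres touch, along the contact normal
(`k + 2 ≤ K` so that the value of `pos (k+1)` there is the analysed one). -/
theorem adj_contact (hP : P.Admissible) (hD : DataOK P e D) {k : ℕ} (hk : k + 2 ≤ P.K) :
    pos P e D (k + 1) (tHit P e D (k + 1)) - pos P e D k (tHit P e D (k + 1)) = P.ε • nk P e D k := by
  have hk' : k + 1 ≤ P.K := (Nat.le_succ _).trans hk
  rw [pos_carrier le_rfl (tHit_lt_succ hP hD hk), pos_spent (tHit_lt_succ hP hD hk').le le_rfl]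
  simp only [sub_self, zero_smul, add_zero]
  exact p_succ_sub_qk hP hD hk'

/-- At the transfer time the two spheres are at distance exactly `ε`. [folklore] -/
theorem adj_contact_norm (hP : P.Admissible) (hD : DataOK P e D) {k : ℕ} (hk : k + 2 ≤ P.K) :
    ‖pos P e D (k + 1) (tHit P e D (k + 1)) - pos P e D k (tHit P e D (k + 1))‖ = P.ε := by
  rw [adj_contact hP hD hk, norm_smul, (stepFacts hP hD ((Nat.le_succ _).trans hk)).cont.n_unit,
    mul_one, Real.norm_of_nonneg hP.ε_pos.le]

/-- After the transfer the new carrier `k+1` runs away from the spent `k`. -/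
theorem adj_sc (hP : P.Admissible) (hD : DataOK P e D) {k : ℕ} (hk : k + 2 ≤ P.K) {t : ℝ}
    (h1 : tHit P e D (k + 1) < t) (h2 : t < tHit P e D (k + 2)) :
    P.ε < ‖pos P e D (k + 1) t - pos P e D k t‖ := by
  have hk' : k + 1 ≤ P.K := (Nat.le_succ _).trans hk
  have hf := stepFacts hP hD hk'
  set θ' := t - tHit P e D (k + 1) with hθ'
  have hθ'pos : 0 < θ' := sub_pos.2 h1
  set n := nk P e D k with hn
  set c := ck P e D k with hc
  set U := relVel D k (carrier P e D k) with hU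
  have hform : pos P e D (k + 1) t - pos P e D k t =
      P.ε • n + θ' • ((2 * c) • n - U) := by
    rw [pos_carrier h1.le h2, pos_spent ((tHit_lt_succ hP hD hk').le.trans h1.le) h1.le,
      ← hθ']
    have hpq := p_succ_sub_qk hP hD hk'
    rw [carrier_succ_W, ρk, hU, relVel, ← hn, ← hc]
    have : (carrier P e D (k + 1)).p + θ' • (D.η (k + 1) + c • n) -
        (qk P e D k + θ' • ((carrier P e D k).W - c • n)) =
        ((carrier P e D (k + 1)).p - qk P e D k) +
          θ' • ((2 * c) • n - ((carrier P e D k).W - D.η (k + 1))) := by module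
    rw [this, hpq]
  have hn1 : ‖n‖ = 1 := hf.cont.n_unit
  have hcdef : ⟪U, n⟫_ℝ = c := rfl
  have hcpos : 0 < c := hP.clo_pos.trans_le hf.cont.c_ge
  have hε := hP.ε_pos
  -- `‖ε n + θ' (2c n - U)‖² = ε² + 2 ε θ' c + θ'² ‖…‖² > ε²`
  have hinner : ⟪P.ε • n, θ' • ((2 * c) • n - U)⟫_ℝ = P.ε * θ' * c := by
    rw [real_inner_smul_left, real_inner_smul_right, inner_sub_right, real_inner_smul_right,
      real_inner_self_eq_norm_sq, hn1, real_inner_comm, hcdef]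
    ring
  have hsq : ‖pos P e D (k + 1) t - pos P e D k t‖ ^ 2 =
      P.ε ^ 2 + 2 * (P.ε * θ' * c) + ‖θ' • ((2 * c) • n - U)‖ ^ 2 := by
    rw [hform, norm_add_sq_real, hinner, norm_smul, hn1, mul_one, Real.norm_of_nonneg hε.le]
  have hgt : P.ε ^ 2 < ‖pos P e D (k + 1) t - pos P e D k t‖ ^ 2 := by
    rw [hsq]
    have : 0 < P.ε * θ' * c := by positivity
    nlinarith [sq_nonneg ‖θ' • ((2 * c) • n - U)‖]
  exact lt_of_pow_lt_pow_left₀ 2 (norm_nonneg _) hgt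

/-- Both spent: the gap `≈ s` reopens (`k + 2 ≤ K`, `tHit (k+2) ≤ t ≤ Tmax`). -/
theorem adj_ss (hS : P.SepOK) (hD : DataOK P e D) {k : ℕ} (hk : k + 2 ≤ P.K) {t : ℝ}
    (h2 : tHit P e D (k + 2) ≤ t) (htT : t ≤ P.Tmax) :
    P.ε < ‖pos P e D (k + 1) t - pos P e D k t‖ := by
  have hP := hS.adm
  have he := hD.e_unit
  have hk' : k + 1 ≤ P.K := (Nat.le_succ _).trans hk
  have hf := stepFacts hP hD hk'
  have hf1 := stepFacts hP hD hk
  have h1 : tHit P e D (k + 1) ≤ t := (tHit_lt_succ hP hD hk).le.trans h2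
  have h0 : tHit P e D k ≤ t := (tHit_lt_succ hP hD hk').le.trans h1
  set n := nk P e D k with hn
  have hform : pos P e D (k + 1) t - pos P e D k t =
      P.ε • n + θk P e D (k + 1) • (carrier P e D (k + 1)).W +
        ((t - tHit P e D (k + 2)) • ρk P e D (k + 1) - (t - tHit P e D (k + 1)) • ρk P e D k) := by
    rw [pos_spent h1 h2, pos_spent h0 h1,
      show qk P e D (k + 1) = (carrier P e D (k + 1)).p + θk P e D (k + 1) • (carrier P e D (k + 1)).W
        from rfl, ← p_succ_sub_qk hP hD hk', show k + 1 + 1 = k + 2 from rfl]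
    abel
  have hn1 : ‖n‖ = 1 := hf.cont.n_unit
  have hne : ⟪n, e⟫_ℝ = 1 - ‖n - e‖ ^ 2 / 2 := inner_eq_one_sub_of_unit hn1 he
  have hndir : ‖n - e‖ ^ 2 ≤ P.αn ^ 2 := pow_le_pow_left₀ (norm_nonneg _) hf.cont.n_dir 2
  have hW := inner_W_e_ge hP hD hk'
  have hθ := hf1.cont.θ_ge
  have hWge : P.Vlo + P.u ≤ ‖(carrier P e D (k + 1)).W‖ := hf1.geom.W_ge'
  have hαs := hS.αs_le
  have hfac : 0 ≤ 1 - P.αs ^ 2 / 2 := by nlinarith [hP.αs_nn]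
  have hθW : P.θlo * (P.Vlo + P.u) * (1 - P.αs ^ 2 / 2) ≤
      ⟪θk P e D (k + 1) • (carrier P e D (k + 1)).W, e⟫_ℝ := by
    rw [real_inner_smul_left]
    have h3 : P.θlo * (P.Vlo + P.u) ≤ θk P e D (k + 1) * ‖(carrier P e D (k + 1)).W‖ :=
      mul_le_mul hθ hWge (by linarith [hP.Vlo_pos, hP.u_nn]) hf1.cont.θ_pos.le
    calc P.θlo * (P.Vlo + P.u) * (1 - P.αs ^ 2 / 2)
        ≤ θk P e D (k + 1) * ‖(carrier P e D (k + 1)).W‖ * (1 - P.αs ^ 2 / 2) :=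
          mul_le_mul_of_nonneg_right h3 hfac
      _ = θk P e D (k + 1) * (‖(carrier P e D (k + 1)).W‖ * (1 - P.αs ^ 2 / 2)) := by ring
      _ ≤ θk P e D (k + 1) * ⟪(carrier P e D (k + 1)).W, e⟫_ℝ :=
          mul_le_mul_of_nonneg_left hW hf1.cont.θ_pos.le
  have hdrift : ‖(t - tHit P e D (k + 2)) • ρk P e D (k + 1) - (t - tHit P e D (k + 1)) • ρk P e D k‖
      ≤ 2 * P.Tmax * P.ρs := by
    have ht2 : 0 ≤ t - tHit P e D (k + 2) := sub_nonneg.2 h2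
    have ht1 : 0 ≤ t - tHit P e D (k + 1) := sub_nonneg.2 h1
    have hT2 : t - tHit P e D (k + 2) ≤ P.Tmax := by have := tHit_nonneg hP hD hk; linarith
    have hT1 : t - tHit P e D (k + 1) ≤ P.Tmax := by have := tHit_nonneg hP hD hk'; linarith
    calc ‖(t - tHit P e D (k + 2)) • ρk P e D (k + 1) - (t - tHit P e D (k + 1)) • ρk P e D k‖
        ≤ ‖(t - tHit P e D (k + 2)) • ρk P e D (k + 1)‖ + ‖(t - tHit P e D (k + 1)) • ρk P e D k‖ :=
          norm_sub_le _ _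
      _ ≤ P.Tmax * P.ρs + P.Tmax * P.ρs := by
          rw [norm_smul, norm_smul, Real.norm_of_nonneg ht2, Real.norm_of_nonneg ht1]
          exact add_le_add (mul_le_mul hT2 hf1.ρ_le (norm_nonneg _) hP.T_nn)
            (mul_le_mul hT1 hf.ρ_le (norm_nonneg _) hP.T_nn)
      _ = 2 * P.Tmax * P.ρs := by ring
  have hinner : P.ε < ⟪pos P e D (k + 1) t - pos P e D k t, e⟫_ℝ := by
    rw [hform, inner_add_left, inner_add_left, real_inner_smul_left, hne]
    have h4 := neg_norm_le_inner_e he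
      ((t - tHit P e D (k + 2)) • ρk P e D (k + 1) - (t - tHit P e D (k + 1)) • ρk P e D k)
    have hadj := hS.adjSS
    have hε := hP.ε_pos
    have h5 : P.ε * (1 - P.αn ^ 2 / 2) ≤ P.ε * (1 - ‖n - e‖ ^ 2 / 2) := by
      refine mul_le_mul_of_nonneg_left ?_ hε.le; linarith
    linarith
  exact hinner.trans_le (inner_e_le_norm he _)

/-! ### Jump times of the block certificate -/

/-- The jump times of the block certificate: `tHit j`, `1 ≤ j`, `j + 1 ≤ K`. -/
def jumpTimes (P : Params) (e : E) (D : BlockData E) : Set ℝ :=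
  (fun j : ℕ => tHit P e D j) '' {j | 1 ≤ j ∧ j + 1 ≤ P.K}

/-- There are finitely many jump times. [folklore] -/
theorem jumpTimes_finite : (jumpTimes P e D).Finite :=
  (Set.finite_Iio (P.K)).subset (fun j hj => by
    simp only [Set.mem_setOf_eq] at hj; simp only [Set.mem_Iio]; omega) |>.image _

/-- Membership in the jump times. [folklore] -/
theorem mem_jumpTimes {c : ℝ} : c ∈ jumpTimes P e D ↔ ∃ j, 1 ≤ j ∧ j + 1 ≤ P.K ∧ tHit P e D j = c := by
  simp only [jumpTimes, Set.mem_image, Set.mem_setOf_eq]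
  constructor
  · rintro ⟨j, ⟨h1, h2⟩, h3⟩; exact ⟨j, h1, h2, h3⟩
  · rintro ⟨j, h1, h2, h3⟩; exact ⟨j, ⟨h1, h2⟩, h3⟩

/-- Hit times of analysable relay spheres are jump times. [folklore] -/
theorem tHit_mem_jumpTimes {j : ℕ} (h1 : 1 ≤ j) (h2 : j + 1 ≤ P.K) : tHit P e D j ∈ jumpTimes P e D :=
  mem_jumpTimes.2 ⟨j, h1, h2, rfl⟩

end BlockTrajectory

end BlockAll

end EquilibriumClampedCollisionalWindowLDNegative

end Summit.AtomisticToContinuum.HydrodynamicLimit.Theorems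

end
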